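import Literature.RingTheory.Koszul.RegularSequenceExact
import Literature.RingTheory.Koszul.HomologyAnnihilator
import Mathlib.Algebra.Module.Torsion.Basic
import HarnessLib

/-!
# The Koszul homology MODULES `H_i(c, M)` are annihilated by the ideal `(c)` (de Smit–Rubin–Schoof Lemma 1.2; Matsumura
# Thm. 16.4, corollary) — object-level form on Mathlib's `HomologicalComplex.homology`

Layer `Literature/RingTheory/Koszul`, sequel of the tree's `HomologyAnnihilator.lean`, which proves the statement at CHAIN
level («`I·Z_m ⊆ B_m`»: `ideal_smul_ker_koszulD_le_range`, `ideal_smul_top_le_range_koszulD_zero`), and of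
`RegularSequenceExact.lean` (`koszulComplex c M : ChainComplex (ModuleCat A) ℕ`).  THIS FILE transports it to the homology
OBJECTS `(koszulComplex c M).homology i` of Mathlib's homology API, which is the form in which the printed sources state it:

> [DeSmitRubinSchoof1997, §1 Lemma 1.2, p. 346] «The homology groups `H_m(f, M)` of `K_•(f, M)` are annihilated by `I`.»
> [Matsumura1987, §16 Thm. 16.4, corollary, p. 127] «if `(x) = (x₁, …, xₙ)`, we have `(x)·H_p(x, M) = 0` for all `p`.»

* §1 a general tool: for a short complex `S` of `A`-modules, if every `a ∈ s` multiplies cycles into boundaries then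
  `S.homology` is `s`-torsion (`ShortComplex.isTorsionBySet_homology_of_smul_cycle_mem`, through Mathlib's `homologyπ` (epi), `iCycles` (mono),
  `toCycles`), and transport of torsion along injective linear maps.
* §2 **`isTorsionBySet_koszulHomology`: `(koszulComplex c M).homology i` is `{c₁, …, cₙ}`-torsion**, equivalently
  `(c)`-torsion (`isTorsionBySet_koszulHomology_span`), `(c) ≤ Ann H_i(c, M)` (`span_le_annihilator_koszulHomology`),
  `a • x = 0` and `a • 𝟙_{H_i} = 0` for `a ∈ (c)` (`smul_koszulHomology_eq_zero`, `smul_id_koszulHomology_eq_zero`), and the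
  degenerate case **`(c) = A ⇒ K_•(c, M)` is exact in every degree** (`koszulComplex_exactAt_of_span_eq_top`).

Not here: the identification `homologyMap (K_•(c, p·id)) = p • 𝟙` (needs the sequel `CoefficientSequence.lean` and Mathlib's
TODO `HomologicalComplex.homologyMap_smul`); the Ext∕Tor forms.

Mathlib status (pin): `Module.IsTorsionBySet`, `Module.annihilator`, `ShortComplex.homologyπ ∕ iCycles ∕ toCycles` (epi ∕ mono in
`ModuleCat`: `ModuleCat.epi_iff_surjective`, `mono_iff_injective`), `HomologicalComplex.homologyIsoSc'`, `Iso.toLinearEquiv`, `Linear A (ModuleCat A)` (`ModuleCat.hom_smul`);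
no Koszul complex in Mathlib.  Theorems only; no definition, no instance, no notation, no named fact, no `sorry`.
-/

namespace Literature.RingTheory.Koszul

universe u v

open CategoryTheory CategoryTheory.Limits

variable {A : Type u} [CommRing A]

/-! ## §1 Torsion of the homology of a short complex of modules -/

section Tool

/-- Torsion by a set is transported backwards along an injective linear map (in particular along a linear equivalence).
[cite: DeSmitRubinSchoof1997, §1 Lemma 1.2 (tool), p. 346] -/
theorem isTorsionBySet_of_injective {M N : Type*} [AddCommGroup M] [Module A M] [AddCommGroup N] [Module A N]
    (f : M →ₗ[A] N) (hf : Function.Injective f) {s : Set A} (hN : Module.IsTorsionBySet A N s) :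
    Module.IsTorsionBySet A M s := by
  intro x a
  apply hf
  rw [map_smul, map_zero]
  exact @hN (f x) a

/-- **If every `a ∈ s` multiplies cycles of `S` into boundaries, the homology of `S` is `s`-torsion** (short complexes of
`A`-modules; via Mathlib's `homologyπ : cycles ↠ homology`, `iCycles : cycles ↪ X₂`, `toCycles`).
[cite: DeSmitRubinSchoof1997, §1 Lemma 1.2 (the form «`I·Z ⊆ B ⇒ I·H = 0`»), p. 346]
[cite: Matsumura1987, §16 Thm. 16.4, corollary, p. 127] -/
theorem ShortComplex.isTorsionBySet_homology_of_smul_cycle_mem (S : ShortComplex (ModuleCat.{v} A)) {s : Set A}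
    (h : ∀ a ∈ s, ∀ z : S.X₂, S.g.hom z = 0 → ∃ w : S.X₁, S.f.hom w = a • z) :
    Module.IsTorsionBySet A S.homology s := by
  rintro q ⟨a, ha⟩
  have hπ : Function.Surjective S.homologyπ.hom := (ModuleCat.epi_iff_surjective _).mp inferInstance
  obtain ⟨k, rfl⟩ := hπ q
  -- the cycle `k`, seen in `S.X₂`, is killed by `g`
  have hk : S.g.hom (S.iCycles.hom k) = 0 := by
    rw [← LinearMap.comp_apply, ← ModuleCat.hom_comp, S.iCycles_g, ModuleCat.hom_zero, LinearMap.zero_apply]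
  obtain ⟨w, hw⟩ := h a ha _ hk
  -- `a • k` is the boundary `toCycles w` (compare in `S.X₂` through the mono `iCycles`)
  have hk' : S.toCycles.hom w = a • k := by
    apply (ModuleCat.mono_iff_injective S.iCycles).mp inferInstance
    rw [map_smul, ← LinearMap.comp_apply, ← ModuleCat.hom_comp, S.toCycles_i, hw]
  change a • S.homologyπ.hom k = 0
  rw [← map_smul, ← hk', ← LinearMap.comp_apply, ← ModuleCat.hom_comp, S.toCycles_comp_homologyπ, ModuleCat.hom_zero,
    LinearMap.zero_apply]

end Tool

/-! ## §2 `(c)·H_i(c, M) = 0` on the homology objects of `koszulComplex c M` -/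

section Koszul

variable {n : ℕ} (c : Fin n → A) (M : Type v) [AddCommGroup M] [Module A M]

/-- Positive degrees, on the explicit short complex `K_{m+2} → K_{m+1} → K_m`: its homology is `{cᵢ}`-torsion
(tree `ideal_smul_ker_koszulD_le_range`: `I·Z_{m+1} ⊆ B_{m+1}`). [cite: DeSmitRubinSchoof1997, §1 Lemma 1.2, p. 346]
[cite: Matsumura1987, §16 Thm. 16.4, corollary, p. 127] -/
theorem isTorsionBySet_homology_sc'_succ (m : ℕ) :
    Module.IsTorsionBySet A ((koszulComplex c M).sc' (m + 2) (m + 1) m).homology (Set.range c) := by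
  refine ShortComplex.isTorsionBySet_homology_of_smul_cycle_mem _ fun a ha z hz => ?_
  have h1 : ((koszulComplex c M).sc' (m + 2) (m + 1) m).g = ModuleCat.ofHom (koszulD c M m) := koszulComplex_d c M m
  have h2 : ((koszulComplex c M).sc' (m + 2) (m + 1) m).f = ModuleCat.ofHom (koszulD c M (m + 1)) :=
    koszulComplex_d c M (m + 1)
  rw [h1] at hz
  have hz' : z ∈ LinearMap.ker (koszulD c M m) := hz
  obtain ⟨w, hw⟩ := ideal_smul_ker_koszulD_le_range c m
    (Submodule.smul_mem_smul (Ideal.subset_span ha) hz')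
  refine ⟨w, ?_⟩
  rw [h2]
  exact hw

/-- Degree `0`, on the explicit short complex `K_1 → K_0 → 0`: its homology `H₀ = M ∕ (c)M` is `{cᵢ}`-torsion
(tree `ideal_smul_top_le_range_koszulD_zero`). [cite: DeSmitRubinSchoof1997, §1 Lemma 1.2 and «`H₀(f, M) = M∕IM`», p. 346]
[cite: Matsumura1987, §16 Thm. 16.4, corollary, p. 127] -/
theorem isTorsionBySet_homology_sc'_zero :
    Module.IsTorsionBySet A ((koszulComplex c M).sc' 1 0 0).homology (Set.range c) := by
  refine ShortComplex.isTorsionBySet_homology_of_smul_cycle_mem _ fun a ha z _ => ?_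
  have h2 : ((koszulComplex c M).sc' 1 0 0).f = ModuleCat.ofHom (koszulD c M 0) := koszulComplex_d c M 0
  obtain ⟨w, hw⟩ := ideal_smul_top_le_range_koszulD_zero c (M := M)
    (Submodule.smul_mem_smul (Ideal.subset_span ha) (Submodule.mem_top (x := z)))
  refine ⟨w, ?_⟩
  rw [h2]
  exact hw

/-- **[DeSmitRubinSchoof1997, Lemma 1.2] ∕ [Matsumura1987, Thm. 16.4, corollary] on the homology OBJECTS: every `cᵢ`
annihilates `H_i(c, M) = (koszulComplex c M).homology i`.** [cite: DeSmitRubinSchoof1997, §1 Lemma 1.2 («the homology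
groups `H_m(f, M)` are annihilated by `I`»), p. 346] [cite: Matsumura1987, §16 Thm. 16.4, corollary («`(x)·H_p(x, M) = 0` for
all `p`»), p. 127] -/
theorem isTorsionBySet_koszulHomology (i : ℕ) :
    Module.IsTorsionBySet A ((koszulComplex c M).homology i) (Set.range c) := by
  rcases i with _ | m
  · exact isTorsionBySet_of_injective
      ((koszulComplex c M).homologyIsoSc' 1 0 0 (by simp) (by simp)).toLinearEquiv.toLinearMap
      ((koszulComplex c M).homologyIsoSc' 1 0 0 (by simp) (by simp)).toLinearEquiv.injective
      (isTorsionBySet_homology_sc'_zero c M)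
  · exact isTorsionBySet_of_injective
      ((koszulComplex c M).homologyIsoSc' (m + 2) (m + 1) m (by simp) (by simp)).toLinearEquiv.toLinearMap
      ((koszulComplex c M).homologyIsoSc' (m + 2) (m + 1) m (by simp) (by simp)).toLinearEquiv.injective
      (isTorsionBySet_homology_sc'_succ c M m)

/-- The same with the ideal `(c) = (c₁, …, cₙ)`: `H_i(c, M)` is `(c)`-torsion.
[cite: DeSmitRubinSchoof1997, §1 Lemma 1.2, p. 346] [cite: Matsumura1987, §16 Thm. 16.4, corollary, p. 127] -/
theorem isTorsionBySet_koszulHomology_span (i : ℕ) :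
    Module.IsTorsionBySet A ((koszulComplex c M).homology i) (Ideal.span (Set.range c)) :=
  (Module.isTorsionBySet_iff_is_torsion_by_span _).mp (isTorsionBySet_koszulHomology c M i)

/-- `a • x = 0` for `a ∈ (c)` and `x ∈ H_i(c, M)`. [cite: DeSmitRubinSchoof1997, §1 Lemma 1.2, p. 346]
[cite: Matsumura1987, §16 Thm. 16.4, corollary, p. 127] -/
theorem smul_koszulHomology_eq_zero (i : ℕ) {a : A} (ha : a ∈ Ideal.span (Set.range c))
    (x : (koszulComplex c M).homology i) : a • x = 0 :=
  @isTorsionBySet_koszulHomology_span A _ n c M _ _ i x ⟨a, ha⟩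

/-- **`(c) ⊆ Ann_A H_i(c, M)`.** [cite: Matsumura1987, §16 Thm. 16.4, corollary («`(x)·H_p(x, M) = 0`»), p. 127]
[cite: DeSmitRubinSchoof1997, §1 Lemma 1.2, p. 346] -/
theorem span_le_annihilator_koszulHomology (i : ℕ) :
    Ideal.span (Set.range c) ≤ Module.annihilator A ((koszulComplex c M).homology i) :=
  fun _ ha => Module.mem_annihilator.mpr fun x => smul_koszulHomology_eq_zero c M i ha x

/-- Endomorphism form: `a • 𝟙_{H_i(c, M)} = 0` in the `A`-linear category `ModuleCat A` for `a ∈ (c)` — the shape in which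
«multiplication by `p ∈ I` on `H_i(K_•(f, M))` is zero» enters the long exact sequence argument of
[DeSmitRubinSchoof1997, Prop. 1.3]. [cite: DeSmitRubinSchoof1997, §1 Lemma 1.2 and proof of Prop. 1.3 («the homology groups of
`K_•(f, M')` are annihilated by `I` and therefore by `pᵢ`»), pp. 346–347] -/
theorem smul_id_koszulHomology_eq_zero (i : ℕ) {a : A} (ha : a ∈ Ideal.span (Set.range c)) :
    a • 𝟙 ((koszulComplex c M).homology i) = 0 := by
  apply ModuleCat.hom_ext
  refine LinearMap.ext fun x => ?_
  rw [ModuleCat.hom_smul, LinearMap.smul_apply, ModuleCat.hom_zero, LinearMap.zero_apply]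
  exact smul_koszulHomology_eq_zero c M i ha _

/-- Degenerate case: **if `(c) = A` (e.g. some `cᵢ` is a unit) then `H_i(c, M) = 0` for every `i`**, i.e. `K_•(c, M)` is exact
in every degree (`1` annihilates the homology). [cite: Matsumura1987, §16 Thm. 16.4, corollary («`(x)·H_p(x, M) = 0`» with
`(x) = A`), p. 127] -/
theorem koszulComplex_exactAt_of_span_eq_top (htop : Ideal.span (Set.range c) = ⊤) (i : ℕ) :
    (koszulComplex c M).ExactAt i := by
  rw [HomologicalComplex.exactAt_iff_isZero_homology, ModuleCat.isZero_iff_subsingleton]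
  refine ⟨fun x y => ?_⟩
  have h1 : (1 : A) ∈ Ideal.span (Set.range c) := htop ▸ Submodule.mem_top
  rw [← one_smul A x, ← one_smul A y, smul_koszulHomology_eq_zero c M i h1, smul_koszulHomology_eq_zero c M i h1]

end Koszul

end Literature.RingTheory.Koszul
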